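import Summits.BirchSwinnertonDyer.Rank1Residual.Additive.TameBranchMuPartDefectTwoFullSqueeze
import Summits.BirchSwinnertonDyer.Rank1Residual.Additive.TameBranchKatoDivisibilityOfKatoMult
import HarnessLib

/-!
# THE (M) TWIN: `TameBranchRatCharEqAt W p` at certified pairs of X4(M) ∩ {`ρ̄` onto} (additive,
# POTENTIALLY MULTIPLICATIVE, EVERY odd `p`) from Kato 17.4 (3) on the multiplicative twist `E♭` +
# Delbourgo 2002 (A)(B) (potentially multiplicative case) + the first-unit-index certificate + the
# squeeze witness / the BSD-side inequality
# (cell `b2b-bsdres`, sub-cell additive-p2 = X3♯(G-ord)/X4♯(G-ord), gen 31; part 7a — the (M) rows)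

HONEST FRAMING (cell `b2b-bsdres`, run/shared/lean/b2b/bsd-rank1-residual/, verbatim in every
file): the goal of the cell is to DELETE the COMBINATION-SHAPED residual classes of the
Birch–Swinnerton-Dyer formula for ALL analytic-rank `≤ 1` elliptic curves over `ℚ` — "full BSD
formula for every rank `≤ 1` curve in class `C`" assembled STRICTLY from published theorems — so
that the rank-`≤ 1` remainder becomes exactly the CONSTRUCTION-SHAPED classes, which are TYPED
(missing-input `Prop`s), NOT attempted. This is not "finishing BSD". The (M) rows (X3♯(M)/X4(M)) are
additive-p1's / team n1011's; this file only CONSUMES their producers by name (the AdditivePotMult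
bricks `isTorsion_and_exists_iota_eq_of_katoHalf`, `ClassX4M.exists_mult_pStar_twist_model`,
`PotMult.towerSurj_twist_of_surj`, gen 22's (M) dictionary) and restates nothing; labels / RESIDUAL-MAP
marks UNCHANGED; nothing is booked (the main conjecture at a pair is NOT `BSD(E,p)`). Theorems only;
published inputs are explicit binders (`hK` = Kato 2004 Thm. 17.4 (3) half-eigenspace reading, `hmodD`,
`hGZK`, `hmod`, `h310`, and `LeadingTermClauses W p Dh` = Delbourgo 2002 (B), supplied on (M) by
n1011-p16's `Delbourgo2002.mainTheorem_potMult`). No definition, no named fact, no `sorry`.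

## What and why

Parts 2–5 of gen 31 settled cc-typer-2's typed rational main conjecture `TameBranchRatCharEqAt W p` at
certified defect-2 pairs of the (G-ord) cell. The OTHER defect-2 cell is (M): `E = E♭ ⊗ χ_{p*}` with
`E♭` MULTIPLICATIVE at `p`; there the integral brick is n1011-p17's
`AdditivePotMult.isTorsion_and_exists_iota_eq_of_katoHalf` (`ι g₁ = C(u·ϖ)·L^±_p(f♭, a_p, ω^{(p−1)/2}, T)`,
`a_p = ±1`, EVERY odd `p`, `p = 3` included) and the dictionary is gen 22's
`isTameBranchOf_legendre_C_mul_padicLFunction{Plus,Minus}BranchMult`. §1 is the tuple step (rigidity +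
rescaling; one non-zero plus symbol of `E`'s newform excludes the degenerate constant); the sequel
`TameBranchRatCharEqPotMultHeadlines.lean` is the class level on X4(M) ∩ {`ρ̄` onto}, EVERY odd `p`,
with the (B)-datum as a binder:

* **`ClassX4M.tameBranchRatCharEqAt_of_katoHalf_of_firstUnit_two_rankZero`** — `r_an = 0`, first unit
  coefficient of `ϖ·L^±_p(f♭, a_p)` at index `2` with non-zero constant term, `2·ord_p #tors < ord_p ∏c`
  (parity route, Greenberg Prop. 3.10) ⟹ `TameBranchRatCharEqAt W p`, `μ = 0`, `λ = 2`;
* **`ClassX4M.tameBranchRatCharEqAt_of_katoHalf_of_fullSqueeze_rankOne`** — `r_an = 1`, a (B)-datum,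
  first unit index `n` (ANY), `[T¹] ≠ 0`, one non-zero plus symbol, `v ≤ ord_p Reg_p(E,Dh)` and
  `v_p([T¹](ϖ·L^±)) + 1 + 2t ≤ v + ord_p ∏c` ⟹ `TameBranchRatCharEqAt W p`, Schneider,
  `ord_p Reg_p = v`, `#Ш[p^∞] = 1`, `μ = 0`, `λ = n` (no parity).

Window (EVIDENCE, X4-2 WINDOW TSV): the (M) cells hold 287 of the 429 certified rank-1 rows ((M)@3:
233 X3 + 36 X4; (M)@5: 15 X3 + 3 X4), all with full-squeeze margin `0`; the X4(M) rows among them are in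
the scope of §2 (`p = 3` included). Nothing booked; labels UNCHANGED.

References: Kato 2004 Thm. 17.4 (3) [Kato2004Asterisque]; Wuthrich 2014 Lemma 20 [Wuthrich2014];
Delbourgo 2002 Thm. (A), (B) p. 40, p. 39 (`ℓ_p = 1` for `ord_p j < 0`) [Delbourgo2002];
Mazur–Tate–Teitelbaum 1986 §I.10, §I.13–I.14 [MazurTateTeitelbaum1986Invent]; Greenberg LNM 1716 Prop.
3.10, §4 [GreenbergLNM1716]; `TameBranchKatoDivisibilityOfKatoMult.lean` (gen 22),
`AdditivePotMult/PotMultRankOneKatoCertificate.lean` (n1011-p17), parts 2–4 of gen 31. -/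

set_option autoImplicit false

noncomputable section

open scoped Classical MatrixGroups ModularForm NumberField

open CongruenceSubgroup IsDedekindDomain WeierstrassCurve NumberField
  Literature.NumberTheory.EllipticCurves
  Literature.NumberTheory.EllipticCurves.ModularForms
  Literature.NumberTheory.EllipticCurves.Rank1Residual
  Literature.NumberTheory.EllipticCurves.Rank1Residual.Typed
  Literature.NumberTheory.EllipticCurves.Delbourgo2002
  Literature.NumberTheory.EllipticCurves.Greenberg1999
  Literature.NumberTheory.GaloisRepresentations
  Summit.BirchSwinnertonDyer.Rank1Residual.AdditivePotMult
  Summit.BirchSwinnertonDyer.Rank1Residual.X1.MuLambda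
  Summit.BirchSwinnertonDyer.Rank1Residual.X1.RankOneParitySqueeze
  Summit.BirchSwinnertonDyer.Rank1Residual.X11a.LambdaNorm

namespace Summit.BirchSwinnertonDyer.Rank1Residual.Additive

/-! ### §1 The tuple step on (M): from `char_Λ X = (g₁)`, `ι g₁ = C(v)·L^±_p(f♭, a_p)` -/

section TuplesMult

open TameBranchMuPart

variable {W : WeierstrassCurve ℚ} [W.IsElliptic] {p : ℕ} [hp : Fact p.Prime]

/-- **Core on (M), even branch (`p ≡ 1 (mod 4)`).** `E = W` additive at `p`, `V = E♭` MULTIPLICATIVE at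
`p` with `C • V^{(p)} = W`, `f`/`g` the newforms of `W`/`V`, `a_p(g) = ap`, `E`'s plus symbol not
identically zero, `I = (g₁)` with `ι g₁ = C(v)·L⁺_p(g, ap, ω^{(p−1)/2}, T)`, `v ≠ 0`, the branch non-zero.
Then for EVERY tuple `(ε, α, B)` of the package with `‖α‖ = 1`: **`I = (g')`, `ι g' = p^k·B`** — gen
22's (M) dictionary + rigidity + rescaling. [cite: MazurTateTeitelbaum1986Invent, §I.10 (10.1), §I.13–I.14] -/
theorem exists_span_eq_and_iota_eq_of_isTameBranchOf_of_iota_eq_plusBranchMult (hp4 : p % 4 = 1)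
    (V : WeierstrassCurve ℚ) [V.IsElliptic]
    (hVW : ∃ C : VariableChange ℚ, C • V.quadraticTwist (p : ℚ) = W) (hadd : Addv W p)
    (hV : Mult V p) {N N' : ℕ} [NeZero N] [NeZero N'] {f : CuspForm (Gamma0 N) 2}
    {g : CuspForm (Gamma0 N') 2} (hf : IsNewformOf W f) (hg : IsNewformOf V g)
    {ap : ℤ} (hap : cuspCoeff g p = ap) (hnd : ∃ s : ℚ, ratPlusSymbol f s ≠ 0)
    {I : Ideal (IwasawaAlgebra p)} {g₁ : IwasawaAlgebra p} (hI : I = Ideal.span {g₁})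
    {v : ℚ_[p]} (hv : v ≠ 0)
    (hι : iwasawaToPowerSeries p g₁ =
      PowerSeries.C v * padicLFunctionPlusBranchMult g ((ap : ℤ) : ℚ_[p]) (p / 2))
    (hB0 : padicLFunctionPlusBranchMult g ((ap : ℤ) : ℚ_[p]) (p / 2) ≠ 0)
    {ε : DirichletCharacter ℂ_[p] p} {α : ℚ_[p]} {B : PowerSeries ℚ_[p]} (hα : ‖α‖ = 1)
    (hB : IsTameBranchOf f p ε α B) :
    ∃ (g' : IwasawaAlgebra p) (k : ℤ), I = Ideal.span {g'} ∧
      iwasawaToPowerSeries p g' = PowerSeries.C ((p : ℚ_[p]) ^ k) * B := by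
  have hp2 : p ≠ 2 := (ne_two_and_legendreSym_neg_one_of_mod_four_eq_one (p := p) hp4).1
  obtain ⟨c, hrel⟩ := exists_legendreTwistPlusRel_of_twist hp4 V W hVW hadd hf hg
  obtain ⟨hap1, hpN⟩ := eq_one_or_eq_neg_one_of_cuspCoeff_eq_of_mult V hV hg hap
  have hdict := isTameBranchOf_legendre_C_mul_padicLFunctionPlusBranchMult hp2 hg.1
    hg.coeffField_eq_bot hpN hap hap1 hrel
  have hc : (c : ℚ_[p]) ≠ 0 := by
    obtain ⟨s, hs⟩ := hnd
    have hc' : c ≠ 0 := by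
      rintro rfl
      exact hs (by rw [hrel s, zero_mul])
    exact_mod_cast hc'
  have hd0 := C_mul_ne_zero hc hB0
  obtain ⟨-, -, hBeq⟩ := hdict.tuple_eq_of_norm_eq_one hp2 hB hd0 hα
  obtain ⟨g', k, hspan, hι'⟩ := exists_span_eq_and_iota_eq_C_zpow_mul hv hc hι
  exact ⟨g', k, by rw [hI, hspan], by rw [hι', hBeq]⟩

/-- **Core on (M), odd branch (`p ≡ 3 (mod 4)`)**: `C • V^{(−p)} = W`, the MINUS branch
`L⁻_p(g, ap, ω^{(p−1)/2}, T)`. [cite: MazurTateTeitelbaum1986Invent, §I.10 (10.1), §I.13–I.14] -/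
theorem exists_span_eq_and_iota_eq_of_isTameBranchOf_of_iota_eq_minusBranchMult (hp4 : p % 4 = 3)
    (V : WeierstrassCurve ℚ) [V.IsElliptic]
    (hVW : ∃ C : VariableChange ℚ, C • V.quadraticTwist (-(p : ℚ)) = W) (hadd : Addv W p)
    (hV : Mult V p) {N N' : ℕ} [NeZero N] [NeZero N'] {f : CuspForm (Gamma0 N) 2}
    {g : CuspForm (Gamma0 N') 2} (hf : IsNewformOf W f) (hg : IsNewformOf V g)
    {ap : ℤ} (hap : cuspCoeff g p = ap) (hnd : ∃ s : ℚ, ratPlusSymbol f s ≠ 0)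
    {I : Ideal (IwasawaAlgebra p)} {g₁ : IwasawaAlgebra p} (hI : I = Ideal.span {g₁})
    {v : ℚ_[p]} (hv : v ≠ 0)
    (hι : iwasawaToPowerSeries p g₁ =
      PowerSeries.C v * padicLFunctionMinusBranchMult g ((ap : ℤ) : ℚ_[p]) (p / 2))
    (hB0 : padicLFunctionMinusBranchMult g ((ap : ℤ) : ℚ_[p]) (p / 2) ≠ 0)
    {ε : DirichletCharacter ℂ_[p] p} {α : ℚ_[p]} {B : PowerSeries ℚ_[p]} (hα : ‖α‖ = 1)
    (hB : IsTameBranchOf f p ε α B) :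
    ∃ (g' : IwasawaAlgebra p) (k : ℤ), I = Ideal.span {g'} ∧
      iwasawaToPowerSeries p g' = PowerSeries.C ((p : ℚ_[p]) ^ k) * B := by
  have hp2 : p ≠ 2 := (ne_two_and_legendreSym_neg_one_of_mod_four_eq_three (p := p) hp4).1
  obtain ⟨c, hrel⟩ := exists_legendreTwistMinusRel_of_twist hp4 V W hVW hadd hf hg
  obtain ⟨hap1, hpN⟩ := eq_one_or_eq_neg_one_of_cuspCoeff_eq_of_mult V hV hg hap
  have hdict := isTameBranchOf_legendre_C_mul_padicLFunctionMinusBranchMult hp2 hg.1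
    hg.coeffField_eq_bot hpN hap hap1 hrel
  have hc : (c : ℚ_[p]) ≠ 0 := by
    obtain ⟨s, hs⟩ := hnd
    have hc' : c ≠ 0 := by
      rintro rfl
      exact hs (by rw [hrel s, zero_mul])
    exact_mod_cast hc'
  have hd0 := C_mul_ne_zero hc hB0
  obtain ⟨-, -, hBeq⟩ := hdict.tuple_eq_of_norm_eq_one hp2 hB hd0 hα
  obtain ⟨g', k, hspan, hι'⟩ := exists_span_eq_and_iota_eq_C_zpow_mul hv hc hι
  exact ⟨g', k, by rw [hI, hspan], by rw [hι', hBeq]⟩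

/-- **Both parities glued, (M).** `W` additive at the odd `p`, `V` globally minimal MULTIPLICATIVE at
`p` with `C • V^{(p*)} = W`, `f` a newform of `W` with a non-zero plus symbol, `Dm` parametrisation data
of `V` with `a_p(Dm.f) = ap`, `ϖ ≠ 0`, and a cyclotomic dual datum whose characteristic ideal is
generated by `g₁` with `ι g₁ = C(u·ϖ)·L^±_p(Dm.f, ap, ω^{(p−1)/2}, T)`, the branch non-zero. Then for
every normalised tuple `(ε, α, B)`: `char_Λ X = (g')`, `ι g' = p^k·B`.
[cite: MazurTateTeitelbaum1986Invent, §I.10 (10.1), §I.13–I.14] -/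
theorem exists_charIdeal_eq_span_and_iota_eq_of_generator_mult (hp2 : p ≠ 2)
    (V : WeierstrassCurve ℚ) [V.IsElliptic] [V.IsGloballyMinimal] (C : VariableChange ℚ)
    (hC : C • V.quadraticTwist ((-1 : ℚ) ^ (p / 2) * p) = W) (hadd : Addv W p) (hV : Mult V p)
    {N N' : ℕ} [NeZero N] [NeZero N'] {f : CuspForm (Gamma0 N) 2} (hf : IsNewformOf W f)
    (hnd : ∃ s : ℚ, ratPlusSymbol f s ≠ 0) (Dm : ModularParametrizationData V N')
    {ap : ℤ} (hap : cuspCoeff Dm.f p = ap) {ϖ : ℚ} (hϖ0 : ϖ ≠ 0)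
    {κ : ZpExtension ℚ p} {γ : Field.absoluteGaloisGroup ℚ} {D : W.SelmerDualData κ γ}
    {g₁ : IwasawaAlgebra p} (hchar : D.charIdeal = Ideal.span {g₁}) {u : ℤ_[p]ˣ}
    (hι : iwasawaToPowerSeries p g₁ =
      PowerSeries.C (((u : ℤ_[p]) : ℚ_[p]) * (ϖ : ℚ_[p])) *
        (if Even (p / 2) then padicLFunctionPlusBranchMult Dm.f ((ap : ℤ) : ℚ_[p]) (p / 2)
          else padicLFunctionMinusBranchMult Dm.f ((ap : ℤ) : ℚ_[p]) (p / 2)))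
    (hB0 : (if Even (p / 2) then padicLFunctionPlusBranchMult Dm.f ((ap : ℤ) : ℚ_[p]) (p / 2)
      else padicLFunctionMinusBranchMult Dm.f ((ap : ℤ) : ℚ_[p]) (p / 2)) ≠ 0)
    {ε : DirichletCharacter ℂ_[p] p} {α : ℚ_[p]} {B : PowerSeries ℚ_[p]} (hα : ‖α‖ = 1)
    (hB : IsTameBranchOf f p ε α B) :
    ∃ (g' : IwasawaAlgebra p) (k : ℤ), D.charIdeal = Ideal.span {g'} ∧
      iwasawaToPowerSeries p g' = PowerSeries.C ((p : ℚ_[p]) ^ k) * B := by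
  have hv : (((u : ℤ_[p]) : ℚ_[p]) * (ϖ : ℚ_[p])) ≠ 0 :=
    mul_ne_zero (PadicInt.coe_ne_zero.mpr u.ne_zero) (by exact_mod_cast hϖ0)
  have hodd : p % 4 = 1 ∨ p % 4 = 3 := by
    obtain ⟨k, hk⟩ := hp.out.odd_of_ne_two hp2
    omega
  rcases hodd with h1 | h3
  · have heven : Even (p / 2) := ⟨p / 4, by omega⟩
    rw [if_pos heven] at hι hB0
    have hC' : C • V.quadraticTwist (p : ℚ) = W := by
      rw [pStar_eq_of_mod_four p (Or.inl h1), if_pos h1] at hC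
      exact hC
    exact exists_span_eq_and_iota_eq_of_isTameBranchOf_of_iota_eq_plusBranchMult h1 V ⟨C, hC'⟩ hadd hV
      hf Dm.isNewformOf hap hnd hchar hv hι hB0 hα hB
  · have hnot : ¬ Even (p / 2) := by rw [Nat.not_even_iff_odd]; exact ⟨p / 4, by omega⟩
    rw [if_neg hnot] at hι hB0
    have hC' : C • V.quadraticTwist (-(p : ℚ)) = W := by
      rw [pStar_eq_of_mod_four p (Or.inr h3), if_neg (by omega)] at hC
      exact hC
    exact exists_span_eq_and_iota_eq_of_isTameBranchOf_of_iota_eq_minusBranchMult h3 V ⟨C, hC'⟩ hadd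
      hV hf Dm.isNewformOf hap hnd hchar hv hι hB0 hα hB

end TuplesMult

end Summit.BirchSwinnertonDyer.Rank1Residual.Additive

end
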